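/-
Copyright (c) 2026. All rights reserved.
Released under Apache 2.0 license as described in the file LICENSE.
Authors: abc-iut cell, prover seat abc-iut-w5-d017 (wave 5, gen 6).
-/
import Literature.IUT.LogVolume.UnitLogDyadicFourthPowers
import HarnessLib

/-!
# Two totally ramified quartic fields `E ⊆ ℚ̄₂` with opposite behaviour of `log₂` on units

Proof-only sequel (theorems, no definitions) of `UnitLogDyadicFourthPowers.lean`, realising its two abstract
quartic instances inside Mathlib's `ℚ̄₂ = PadicAlgCl 2` (pattern of abc-iut-w5-d172's
`WildDyadic.exists_absRamificationIdx_eq_two_residueDegree_eq_one`):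

* `absRamificationIdx_eq_four_of_norm_pow_four` — a finite `E ⊆ ℚ̄₂` with `[E : ℚ₂] ≤ 4` containing `π` with
  `‖π‖⁴ = ‖2‖` has `e(E/ℚ₂) = 4` and `f(E/ℚ₂) = 1` (`‖π‖ ≤ 2^{−1/e}` forces `e ≥ 4`; `e·f = [E : ℚ₂] ≤ 4`);
* **`exists_quartic_field_norm_unitLog_eq_one`** — `E = ℚ₂(α)`, `α⁴ + 2α² + 6 = 0`: `e = 4`, `f = 1`, and SOME
  unit of `𝒪_E` has a unit `2`-adic logarithm (`u = 1 + α`);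
* **`exists_quartic_field_norm_unitLog_ne_one`** — `E = ℚ₂(2^{1/4})`: `e = 4`, `f = 1`, and NO `u : E` has
  `‖log₂ u‖ = 1`.

Hence the clause «`f(v|2) = 1`, `4 ∣ e(v|2)`» of the cell's (Ind3) honest-model census is GENUINELY
field-dependent (kernel certificate of both behaviours at `e = 4`).  Classical (Neukirch, *Algebraic Number
Theory* II (5.5)).  Nothing here is disputed mathematics; no IUT statement is asserted; nothing bears on
[IUTchIII] Cor. 3.12.
-/

noncomputable section

open Metric Set

namespace Literature.IUT.LogVolume

namespace RamificationCriterion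

open Literature.NumberTheory.GaloisRepresentations.Ultrametric
open Polynomial IntermediateField

/-- **`[E : ℚ₂] ≤ 4` and `‖π‖⁴ = ‖2‖` for some `π ∈ E` ⇒ `e(E/ℚ₂) = 4`, `f(E/ℚ₂) = 1`** (`‖π‖ ≤ 2^{−1/e}`, so
`2^{−1} = ‖π‖⁴ ≤ 2^{−4/e}`, `e ≥ 4`; and `e·f = [E : ℚ₂] ≤ 4`, `f ≥ 1`). [cite: NeukirchANT1999, Ch. II (5.5)] -/
theorem absRamificationIdx_eq_four_of_norm_pow_four {E : IntermediateField ℚ_[2] (PadicAlgCl 2)}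
    [FiniteDimensional ℚ_[2] E] (hdeg : Module.finrank ℚ_[2] E ≤ 4) {π : E} (hπ : ‖π‖ ^ 4 = ‖(2 : E)‖) :
    absRamificationIdx 2 E = 4 ∧ residueDegree 2 E = 1 := by
  have hef := absRamificationIdx_mul_residueDegree 2 (E : Type _)
  have hf := residueDegree_pos 2 (E : Type _)
  have hnorm4 : ‖π‖ ^ 4 = 2⁻¹ := by
    rw [hπ]
    have := norm_prime 2 (E : Type _)
    simpa using this
  have hπlt : ‖π‖ < 1 :=
    (pow_lt_one_iff_of_nonneg (norm_nonneg _) (by norm_num : (4 : ℕ) ≠ 0)).mp (by rw [hnorm4]; norm_num)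
  have hdisc := norm_le_rpow_of_norm_lt_one 2 (E : Type _) hπlt
  set e := absRamificationIdx 2 E with hedef
  have he0 : (0 : ℝ) < e := by exact_mod_cast absRamificationIdx_pos 2 (E : Type _)
  have h4 : ‖π‖ ^ 4 ≤ ((2 : ℝ) ^ (-(1 / (e : ℝ)))) ^ 4 := pow_le_pow_left₀ (norm_nonneg _) hdisc 4
  rw [hnorm4, ← Real.rpow_natCast, ← Real.rpow_mul (by norm_num), ← Real.rpow_neg_one,
    Real.rpow_le_rpow_left_iff (by norm_num : (1 : ℝ) < 2)] at h4
  have hege : (4 : ℝ) ≤ e := by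
    have h := mul_le_mul_of_nonneg_right h4 he0.le
    field_simp at h
    push_cast at h
    nlinarith
  have hege' : 4 ≤ e := by exact_mod_cast hege
  have hprod : e * residueDegree 2 E ≤ 4 := hef.trans_le hdeg
  constructor
  · nlinarith
  · nlinarith

/-- **`E = ℚ₂(α) ⊆ ℚ̄₂` with `α⁴ + 2α² + 6 = 0`: `e = 4`, `f = 1`, and a unit of `𝒪_E` has a unit `2`-adic
logarithm** (`u = 1 + α`; `UnitLogDyadicFourthPowers.lean`). [cite: NeukirchANT1999, Ch. II (5.5)] -/
theorem exists_quartic_field_norm_unitLog_eq_one :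
    ∃ (E : IntermediateField ℚ_[2] (PadicAlgCl 2)) (_ : FiniteDimensional ℚ_[2] E),
      absRamificationIdx 2 E = 4 ∧ residueDegree 2 E = 1 ∧ ∃ u : E, ‖u‖ = 1 ∧ ‖unitLog u‖ = 1 := by
  set P : ℚ_[2][X] := X ^ 4 + C 2 * X ^ 2 + C 6 with hP
  have hPmonic : P.Monic := by
    rw [hP]
    -- leading term `X^4`
    refine Monic.add_of_left (Monic.add_of_left (monic_X_pow 4) ?_) ?_
    · exact (degree_C_mul_X_pow_le _ _).trans_lt (by rw [degree_X_pow]; norm_num)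
    · refine (degree_C_le).trans_lt ?_
      rw [degree_add_eq_left_of_degree_lt] <;> rw [degree_X_pow]
      · norm_num
      · exact (degree_C_mul_X_pow_le _ _).trans_lt (by norm_num)
  have hPdeg : P.natDegree = 4 := by
    rw [hP]
    rw [natDegree_add_eq_left_of_natDegree_lt, natDegree_add_eq_left_of_natDegree_lt, natDegree_X_pow]
    · exact (natDegree_C_mul_X_pow_le _ _).trans_lt (by rw [natDegree_X_pow]; norm_num)
    · refine (natDegree_C _).le.trans_lt ?_
      rw [natDegree_add_eq_left_of_natDegree_lt] <;> rw [natDegree_X_pow]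
      · norm_num
      · exact (natDegree_C_mul_X_pow_le _ _).trans_lt (by norm_num)
  obtain ⟨α, hα⟩ : ∃ α : PadicAlgCl 2, Polynomial.aeval α P = 0 := by
    have hdeg' : (P.map (algebraMap ℚ_[2] (PadicAlgCl 2))).degree ≠ 0 := by
      rw [degree_map, degree_eq_natDegree hPmonic.ne_zero, hPdeg]; norm_num
    obtain ⟨α, hα⟩ := IsAlgClosed.exists_root _ hdeg'
    exact ⟨α, by rwa [IsRoot.def, eval_map, ← aeval_def] at hα⟩
  have hint : IsIntegral ℚ_[2] α := ⟨P, hPmonic, by simpa [Polynomial.aeval_def] using hα⟩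
  haveI hfd : FiniteDimensional ℚ_[2] ℚ_[2]⟮α⟯ := adjoin.finiteDimensional hint
  set π : ℚ_[2]⟮α⟯ := ⟨α, mem_adjoin_simple_self ℚ_[2] α⟩ with hπdef
  have hαeq : α ^ 4 + 2 * α ^ 2 + 6 = 0 := by
    have h2 : algebraMap ℚ_[2] (PadicAlgCl 2) 2 = 2 := map_ofNat _ 2
    have h6 : algebraMap ℚ_[2] (PadicAlgCl 2) 6 = 6 := map_ofNat _ 6
    simpa [hP, h2, h6] using hα
  have hπ : π ^ 4 + 2 * π ^ 2 + 6 = 0 := by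
    apply Subtype.ext
    have h2E : ((2 : ℚ_[2]⟮α⟯) : PadicAlgCl 2) = 2 := map_ofNat (algebraMap ℚ_[2]⟮α⟯ (PadicAlgCl 2)) 2
    have h6E : ((6 : ℚ_[2]⟮α⟯) : PadicAlgCl 2) = 6 := map_ofNat (algebraMap ℚ_[2]⟮α⟯ (PadicAlgCl 2)) 6
    simpa [hπdef, h2E, h6E] using hαeq
  have hdeg : Module.finrank ℚ_[2] ℚ_[2]⟮α⟯ ≤ 4 := by
    rw [adjoin.finrank hint]
    have hdvd : minpoly ℚ_[2] α ∣ P := minpoly.dvd ℚ_[2] α hα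
    calc (minpoly ℚ_[2] α).natDegree ≤ P.natDegree := natDegree_le_of_dvd hdvd hPmonic.ne_zero
      _ = 4 := hPdeg
  obtain ⟨he, hf⟩ := absRamificationIdx_eq_four_of_norm_pow_four hdeg (norm_pow_four_eq_of_quartic hπ)
  exact ⟨ℚ_[2]⟮α⟯, hfd, he, hf, exists_norm_unitLog_eq_one_of_quartic ⟨π, hπ⟩⟩

/-- **`E = ℚ₂(2^{1/4}) ⊆ ℚ̄₂`: `e = 4`, `f = 1`, and NO `u : E` has `‖log₂ u‖ = 1`**
(`UnitLogDyadicFourthPowers.lean`, `ϖ₀⁴ = 2`). [cite: NeukirchANT1999, Ch. II (5.5)] -/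
theorem exists_quartic_field_norm_unitLog_ne_one :
    ∃ (E : IntermediateField ℚ_[2] (PadicAlgCl 2)) (_ : FiniteDimensional ℚ_[2] E),
      absRamificationIdx 2 E = 4 ∧ residueDegree 2 E = 1 ∧ ∀ u : E, ‖unitLog u‖ ≠ 1 := by
  obtain ⟨α, hα⟩ := IsAlgClosed.exists_pow_nat_eq (2 : PadicAlgCl 2) (by norm_num : 0 < 4)
  have h2 : algebraMap ℚ_[2] (PadicAlgCl 2) 2 = 2 := map_ofNat _ 2
  have heval : Polynomial.aeval α (X ^ 4 - C (2 : ℚ_[2])) = 0 := by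
    simp [hα, h2]
  have hint : IsIntegral ℚ_[2] α := ⟨X ^ 4 - C 2, monic_X_pow_sub_C 2 (by norm_num), by
    simpa [Polynomial.aeval_def] using heval⟩
  haveI hfd : FiniteDimensional ℚ_[2] ℚ_[2]⟮α⟯ := adjoin.finiteDimensional hint
  set π : ℚ_[2]⟮α⟯ := ⟨α, mem_adjoin_simple_self ℚ_[2] α⟩ with hπdef
  have hπ : π ^ 4 = 2 := by
    apply Subtype.ext
    have h2E : ((2 : ℚ_[2]⟮α⟯) : PadicAlgCl 2) = 2 := map_ofNat (algebraMap ℚ_[2]⟮α⟯ (PadicAlgCl 2)) 2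
    simpa [hπdef, h2E] using hα
  have hdeg : Module.finrank ℚ_[2] ℚ_[2]⟮α⟯ ≤ 4 := by
    rw [adjoin.finrank hint]
    have hdvd : minpoly ℚ_[2] α ∣ X ^ 4 - C 2 := minpoly.dvd ℚ_[2] α heval
    have hne : (X ^ 4 - C (2 : ℚ_[2])) ≠ 0 := (monic_X_pow_sub_C 2 (by norm_num)).ne_zero
    calc (minpoly ℚ_[2] α).natDegree ≤ (X ^ 4 - C (2 : ℚ_[2])).natDegree := natDegree_le_of_dvd hdvd hne
      _ = 4 := natDegree_X_pow_sub_C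
  have hnorm : ‖π‖ ^ 4 = ‖(2 : ℚ_[2]⟮α⟯)‖ := by rw [← norm_pow, hπ]
  obtain ⟨he, hf⟩ := absRamificationIdx_eq_four_of_norm_pow_four hdeg hnorm
  exact ⟨ℚ_[2]⟮α⟯, hfd, he, hf, fun u ↦ norm_unitLog_ne_one_of_pow_four_eq_two he hf hπ u⟩

/-- **Both behaviours occur among totally ramified quartic `E/ℚ₂`** (census form: the clause «`f = 1`, `4 ∣ e`»
is field-dependent). [cite: NeukirchANT1999, Ch. II (5.5)] -/
theorem exists_quartic_fields_logUnits_inter_sphere_both :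
    (∃ (E : IntermediateField ℚ_[2] (PadicAlgCl 2)) (_ : FiniteDimensional ℚ_[2] E),
      absRamificationIdx 2 E = 4 ∧ residueDegree 2 E = 1 ∧ (logUnits E ∩ sphere 0 1).Nonempty) ∧
    (∃ (E : IntermediateField ℚ_[2] (PadicAlgCl 2)) (_ : FiniteDimensional ℚ_[2] E),
      absRamificationIdx 2 E = 4 ∧ residueDegree 2 E = 1 ∧ logUnits E ∩ sphere 0 1 = ∅) := by
  constructor
  · obtain ⟨E, hE, he, hf, u, hu, hlog⟩ := exists_quartic_field_norm_unitLog_eq_one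
    exact ⟨E, hE, he, hf, unitLog u, ⟨u, hu, rfl⟩, mem_sphere_zero_iff_norm.mpr hlog⟩
  · obtain ⟨E, hE, he, hf, hall⟩ := exists_quartic_field_norm_unitLog_ne_one
    refine ⟨E, hE, he, hf, ?_⟩
    ext z
    simp only [mem_inter_iff, mem_sphere_zero_iff_norm, mem_empty_iff_false, iff_false, not_and]
    rintro ⟨u, -, rfl⟩
    exact hall u

end RamificationCriterion

end Literature.IUT.LogVolume

end
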